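import Mathlib
import Summits.MatrixMultiplication.MatrixMultiplication.Theses.FourierTwoFamiliesModP
import Summits.MatrixMultiplication.MatrixMultiplication.Theorems.PrimeLogDecay.Negative.LoadBearing
import Literature.Computability.AlgebraicComplexity.SimultaneousDoubleProduct

/-!
# Line `km-mixing-colour-deficit` — skeleton for crux `PrimeLogDecay` (stmt-MatrixMultiplication-14310)

Route `FourierTwoFamiliesModP`, crux rank 3 (fixed, the route's decl):
`∃ c > 0 ∃ s₀ ∀ p prime ∀ n s (A B : Fin n → Finset (ZMod p)), s₀ ≤ s → |A i| = |B i| = s → (W) → (X) →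
n·s·(log s)^c ≤ p`, i.e. density `ρ := n s / p ≤ (log s)^{-c}`.

Notation (informal): `X = ⊔ A i`, `Y = ⊔ B i` (`blockUnion`), `Δ = ⋃ⱼ (A j − B j)` (`delta`),
`r_{U,V}(d) = #{(u,v) ∈ U × V : u − v = d}`, `B = bohr Γ ν` a Bohr set of rank `d = |Γ|` in `ZMod p`
(`znorm`, `bohr`, `IsRegularBohr` below, the Bourgain/Tao–Vu notion with constant `100(d+1)`),
`B_κ = bohr Γ (coreWidth d · ν)` its narrow core, `x + B` the translate `(bohr Γ ν).image (x + ·)`,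
`λ = log s`.

## The idea (card km-mixing-colour-deficit v2, ideator 1; triage r1 ×3 pass, merged with km-sifting /
hereditary-deficit) and what the panel did to it

LEVER (exact COLOUR DEFICIT): by (W)+(X), a pair `(u,v) ∈ X × Y` has `u − v ∈ Δ` iff it is a matched
(same-index) pair, so `#{(u,v) ∈ X×Y : u − v ∈ Δ} = n s²` exactly — and the same for every family of
sub-blocks `A' i ⊆ A i`, `B' i ⊆ B i` (windows): the `Δ`-difference graph on `X × Y` is `⊔ K(A i, B i)`,
sparser than random by the factor `ρ s` beyond the wall.  ENGINE: Kelley–Meka two-sided mixing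
(arXiv:2302.05537 Thm 2.11 + Prop 2.12 decoupling; Thm 2.8 / Bloom–Sisask arXiv:2302.07211 Prop 14 for the
increment) turns "few pairs into a test set of relative density `2^{-k}`" into a CONSTANT-FACTOR density
increment of `X` or `Y` on a Bohr set, cost rank `+O(L⁴k⁴)`, size `×exp(−O(L⁵k⁵ + d log d))`.
PANEL (TRIAGE-r1-1/2/3): lever and engine sound for ONE round; every further round needs a window PAIR
in which both unions are dense AND the test set is again relatively dense ("hereditary test density /
paired localisation", = delta-trace-rigidity K1) — unproved, the shared load-bearing bet of all KM cards;
the card's regime claims (`n ≤ s·e^{(log s)^{1/6}}`, thin-rich) are one-round conditions (App. A7/A8 of r1-3).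

## This skeleton: ONE sifting step after a two-set SPREADNESS DESCENT (5 registered stubs)

Instead of iterating deficit rounds (which is where the hereditary clause bites), the line runs the
Kelley–Meka density-increment framework in its GREEDY form (KM Prop 2.15 "spread relative to its span",
here relative to regular Bohr sets with a per-step budget): first `X` is made relatively spread (no
`(1+ε)`-denser admissible refinement), then `Y` inside, with HIERARCHICAL budgets so that `X`'s spreadness
horizon covers `Y`'s whole descent; both descents take `O_C(log(1/ρ))` steps because densities are `≤ 1`.
At the end ONE application of the two-set sifting dichotomy (`BohrSifting`) to a window pair that is
near-maximally dense on both sides and has a `Δ`-THICK narrow core produces a `(1+1/C)`-increment of `X`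
or `Y` inside both horizons — contradicting spreadness.  The deficit hypothesis of that one application
is certified by the colour-deficit identity (`ColourDeficit`) + Markov: on `Δ` the cross-representation
function `r_{U,V}` counts only matched pairs, `≤ s·|U|` of them, so wherever `Δ` fills a `2·2^{-k}`
fraction of the core, half of that is a valley `{r_{U,V} ≤ |U||V|/(16|B|)}`.  Hence the ENTIRE structural
content of the line is isolated in ONE statement about `Δ` alone:

* `stub_thickCore` — THE BET (open; `ThickCore`): for a dense balanced SDPP family (`ρ ≥ λ^{-c}`, `s ≥ s₀`)
  and any admissible regular Bohr window `B` (rank `≤ λ^{9/10}`, `|B| ≥ p·e^{−λ^{19/20}}`), among the centres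
  `x` where `X` is dense (a set filling 99% of a coarser window translate) and `y` where `Y` is dense
  (likewise) there is a pair whose difference core `(x − y) + B_κ` contains `Δ` at relative density
  `≥ 2·2^{-k}`, `k = ⌈λ^{1/10}⌉`.  It is IMPLIED BY THE CRUX (vacuous once no dense family exists), so it
  cannot be refuted without refuting the crux; it is the panel's "hereditary test density" in its weakest
  consumable form (one scale, one pair, a statement about `Δ` only — no matched-mass or block-localisation
  clause survives: the deficit is free on `Δ` by `ColourDeficit`).  Every known near-extremal design
  (translates, CKSU/CRT cubes, chain menus) is digit-like and has thick cores at every coordinate scale; in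
  bounded dilution `p ≤ s² e^{λ^{1/10}/2}` thickness holds on average over all cores.
* `stub_bohrSifting` — THE ENGINE (`BohrSifting`, XL, print-adjacent = km-sifting K2): Bohr-relative two-set
  Kelley–Meka dichotomy in `ZMod p`: `U ⊆ x+B`, `V ⊆ y+B`, test set `T` in the narrow core `(x−y)+B_κ` with
  `|T| ≥ 2^{-k}|B_κ|` receiving at most `1/8` of the nominal `|U||V||T|/|B|` pairs ⟹ a regular refinement
  `B₁ = bohr Γ₁ ν₁` (`Γ ⊆ Γ₁`, rank `+ C·L⁸`, `|B₁| ≥ e^{−C(d log(2d) + L⁸)}|B|`,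
  `L = log(2|B|/|U|) + log(2|B|/|V|) + k`) and a translate on which `U` or `V` is `(1+1/C)` times denser.
  Sources: KM Thm 2.8/2.11, Prop 2.12–2.14, Lemma 2.10 (sifting, general `G`); BS Prop 14, Lemma 15, Thm 16
  (Bohr-relative unbalancing / almost-periodicity with `A₁ ≠ A₂`).  Exponent 8 and the size floor
  `|B| ≥ e^{C(d log 2(d+1) + L⁸)}` are deliberately generous (the floor makes the statement vacuous outside
  the dense regime `L⁸ ≲ log|B|`).  Needs the Bohr-set API (D1 of every KM card): `znorm/bohr/IsRegularBohr`.
* `stub_bohrBasics` — (`BohrBasics`, provable now, M): regular widths exist in every dyadic range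
  (Bourgain; Tao–Vu Lemma 4.25) and narrowing costs `|bohr Γ (θν)| ≥ (θ/4)^{2d+2}|bohr Γ ν|` (doubling
  `|B_{2ν}| ≤ 4^d|B_ν|`, Tao–Vu Lemma 4.20).  Mathlib-only; shared infrastructure with the engine.
* `stub_colourDeficit` — (`ColourDeficit`, provable now, M): the hereditary colour-deficit identity
  `#{(u,v) ∈ (⋃A'ᵢ)×(⋃B'ᵢ) : u − v ∈ Δ(A,B)} = Σᵢ |A'ᵢ||B'ᵢ|` for sub-blocks of a balanced SDPP family
  (blocks pairwise disjoint by tree `IsSDPP.disjoint_left/right_of_simultaneous`; F0: `u ∈ A i`, `v ∈ B k`,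
  `u − v ∈ A j − B j` ⟹ (X) with `(i,j,k)` ⟹ `i = k`).
* `stub_spreadDescent` — BOOKKEEPING (L): `ColourDeficit → BohrBasics → BohrSifting → ThickCore →
  DenseRegimeLogDecay` (the crux's conclusion for families beyond `4×` the wall, constants `c := c₃`,
  `s₀` large): penalised maximisation `density·(1+ε)^{-j}` over admissible windows reachable in `j` budget
  units gives the relatively spread windows (finite `Finset.exists_max_image`), `X` with horizon
  `(R₁+2)·(per-step budget)`, `R₁ = ⌈log(1/ρ)/log(1+ε)⌉`, `ε = 1/(4C)`; one final narrowing by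
  `θ = ερ/(2·10⁴(d+1))` (BohrBasics) makes 99% of the coarse translates `(1−1/(4C))`-near-maximal (Markov);
  ThickCore picks the pair, ColourDeficit + Markov the valley `T` (`|T| ≥ |Δ ∩ core| − 32 s λ^{c}`),
  BohrSifting the increment `(1+1/C)(1−1/4C) > 1+ε` inside both horizons: contradiction.  Budget check
  (large `s`): total rank `O(C³c²(log λ)² λ^{4/5}) ≤ λ^{9/10}`, total log-size-loss
  `O(C³c²(log λ)³ λ^{9/10}) ≤ λ^{19/20}`, sifting floor `e^{C(…)} ≤ e^{λ} ≤ s² e^{−λ^{19/20}} ≤ |B|`,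
  Markov slack `2^{-k}|B_κ| ≥ s^{1.8} ≫ 32 s λ^c` (uses `p ≥ s²`, tree `IsSDPP.card_mul_card_le`).

`PrimeLogDecay_of : PrimeLogDecay` (kernel-checked, sorry-free outside the stubs) feeds the four
statement stubs to `stub_spreadDescent` and adds the sparse regime `n s² < 4p` (there
`n s (log s)^{c'} ≤ n s²/4 < p` for `s ≥ 64`, `c' = min c 1`), through the disprover's explicit-constant
form `Negative.PrimeLogDecayWith` / `primeLogDecay_iff`.

Disproof used (landed `Theorems/PrimeLogDecay/Negative/{LoadBearing,ChainMenuDesign}.lean`; the v3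
`Disproof.lean` under run/gate/evidence is not mounted on this hub, read via its evidence notes):
`primeLogDecay_false_without_W` — (W) is used by `ColourDeficit` (directness is what makes the matched
pairs of a block inject into `Δ`; block disjointness) and by the descent (`p ≥ s²`);
`primeLogDecay_false_without_X` — (X) IS the colour deficit (F0); `not_primeLogDecayWith_13_3` /
`card_translateClass_mul_le` — translates (`ρ = 1/s`) and every bounded-shape design are far inside the
sparse side of `ThickCore`'s density hypothesis `ρ ≥ λ^{-c}`, and the composition goes through
`PrimeLogDecayWith (min c 1) (max s₀ 64)`, consistent with "`s₀` must grow with `c`"; chain menus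
(`isSDPP_menu12_pi`, `ρ = s^{-0.585}`) likewise never meet the dense hypothesis.  No landed Negative lemma
refutes an instance of any stub (ledger negatives 2026-08-16: 4 unrelated entries).
-/

set_option linter.unusedVariables false
set_option linter.dupNamespace false

namespace Summit.MatrixMultiplication.MatrixMultiplication.Cruxes.PrimeLogDecay.KmMixingColourDeficit

open scoped BigOperators Pointwise
open Finset
open Summit.MatrixMultiplication.MatrixMultiplication.Theses.FourierTwoFamiliesModP (PrimeLogDecay)
open Summit.MatrixMultiplication.MatrixMultiplication.Theorems.PrimeLogDecay.Negative
  (PrimeLogDecayWith primeLogDecay_iff)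

/-! ## Objects -/

section Defs

variable {p n : ℕ}

/-- `X = ⊔ A i` (resp. `Y = ⊔ B i`). -/
def blockUnion (A : Fin n → Finset (ZMod p)) : Finset (ZMod p) := Finset.univ.biUnion A

/-- The matched-difference set `Δ = ⋃ⱼ (A j − B j)`. -/
def delta (A B : Fin n → Finset (ZMod p)) : Finset (ZMod p) := Finset.univ.biUnion fun j => A j - B j

/-- Number of pairs `(u, v) ∈ U × V` with `u − v ∈ T` (i.e. `Σ_{t ∈ T} r_{U,V}(t)`). -/
def crossPairs (U V T : Finset (ZMod p)) : ℕ := ((U ×ˢ V).filter fun q => q.1 - q.2 ∈ T).card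

/-- `‖x/p‖_{ℝ/ℤ}`: distance from the least residue of `x` to the nearest multiple of `p`, over `p`. -/
noncomputable def znorm (x : ZMod p) : ℝ := ((min x.val (p - x.val) : ℕ) : ℝ) / (p : ℝ)

/-- The Bohr set `bohr Γ ν = {x : ‖ξ x / p‖ ≤ ν for all ξ ∈ Γ}` of frequency set `Γ` (rank `|Γ|`) and
width `ν`. -/
noncomputable def bohr [NeZero p] (Γ : Finset (ZMod p)) (ν : ℝ) : Finset (ZMod p) :=
  Finset.univ.filter fun x => ∀ ξ ∈ Γ, znorm (ξ * x) ≤ ν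

/-- Regularity of the Bohr set `bohr Γ ν` (Bourgain; Tao–Vu Def. 4.24 with `d` replaced by `|Γ| + 1`):
`|bohr Γ ((1 ± κ)ν)| = (1 ± 100(|Γ|+1)κ)·|bohr Γ ν|` for `0 ≤ κ ≤ 1/(100(|Γ|+1))`. -/
def IsRegularBohr [NeZero p] (Γ : Finset (ZMod p)) (ν : ℝ) : Prop :=
  ∀ κ : ℝ, 0 ≤ κ → 100 * ((Γ.card : ℝ) + 1) * κ ≤ 1 →
    ((bohr Γ ((1 + κ) * ν)).card : ℝ) ≤ (1 + 100 * ((Γ.card : ℝ) + 1) * κ) * (bohr Γ ν).card ∧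
    (1 - 100 * ((Γ.card : ℝ) + 1) * κ) * (bohr Γ ν).card ≤ ((bohr Γ ((1 - κ) * ν)).card : ℝ)

end Defs

/-- Width factor of the NARROW CORE of a rank-`d` window: `B_κ = bohr Γ (coreWidth |Γ| · ν)`; regularity
makes the rim `B ∖ B_{1−κ}` at most a `100(d+1)κ < 1/10` fraction of `B`. -/
noncomputable def coreWidth (d : ℕ) : ℝ := 1 / (2 ^ 10 * ((d : ℝ) + 1))

/-- Per-application cost scale of the sifting dichotomy at rank `d` with logarithmic parameter `L`:
`(d+1)·log(2(d+1)) + L⁸` (rank grows by `≤ C·L⁸`, size shrinks by `≤ exp(C · siftCost d L)`). -/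
noncomputable def siftCost (d : ℕ) (L : ℝ) : ℝ := ((d : ℝ) + 1) * Real.log (2 * ((d : ℝ) + 1)) + L ^ 8

/-- Sanity: rank `0` windows are the whole group (the descent starts here). -/
example {p : ℕ} [NeZero p] (ν : ℝ) : bohr (∅ : Finset (ZMod p)) ν = Finset.univ := by
  simp [bohr]

/-- Sanity: `0` lies in every Bohr set of non-negative width. -/
example {p : ℕ} [NeZero p] (Γ : Finset (ZMod p)) {ν : ℝ} (hν : 0 ≤ ν) : (0 : ZMod p) ∈ bohr Γ ν := by
  simp [bohr, znorm, hν]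

/-! ## The five stub statements -/

/-- STUB 1 statement (provable now, M) — HEREDITARY COLOUR-DEFICIT IDENTITY: for sub-blocks `A' i ⊆ A i`,
`B' i ⊆ B i` of a balanced SDPP family, the pairs `(u,v) ∈ (⋃A' i) × (⋃B' i)` with `u − v` in the ORIGINAL
matched-difference set `Δ(A,B)` are exactly the same-index pairs: their number is `Σ i |A' i|·|B' i|`. -/
def ColourDeficit : Prop :=
  ∀ (p n s : ℕ) (A B A' B' : Fin n → Finset (ZMod p)), 1 ≤ s →
    (∀ i : Fin n, (A i).card = s ∧ (B i).card = s) →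
    (∀ i : Fin n, ∀ a ∈ A i, ∀ a' ∈ A i, ∀ b ∈ B i, ∀ b' ∈ B i, (a - a') + (b - b') = 0 → a = a' ∧ b = b') →
    (∀ i j k : Fin n, ∀ a ∈ A i, ∀ a' ∈ A j, ∀ b ∈ B j, ∀ b' ∈ B k, (a - a') + (b - b') = 0 → i = k) →
    (∀ i, A' i ⊆ A i) → (∀ i, B' i ⊆ B i) →
    crossPairs (blockUnion A') (blockUnion B') (delta A B) = ∑ i, (A' i).card * (B' i).card

/-- STUB 2 statement (provable now, M) — BOHR BASICS: (i) regular widths exist in every dyadic range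
`[ν₀/2, ν₀]` (Bourgain; Tao–Vu Lemma 4.25); (ii) narrowing a Bohr set of rank `d` by a factor `θ` costs at
most `(θ/4)^{2d+2}` of its size (from the doubling bound `|B_{2ν}| ≤ 4^d |B_ν|`, Tao–Vu Lemma 4.20). -/
def BohrBasics : Prop :=
  (∀ (p : ℕ) [NeZero p] (Γ : Finset (ZMod p)) (ν₀ : ℝ), 0 < ν₀ → ν₀ ≤ 1 / 8 →
      ∃ ν : ℝ, ν₀ / 2 ≤ ν ∧ ν ≤ ν₀ ∧ IsRegularBohr Γ ν) ∧
  (∀ (p : ℕ) [NeZero p] (Γ : Finset (ZMod p)) (ν θ : ℝ), 0 < ν → ν ≤ 1 / 8 → 0 < θ → θ ≤ 1 →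
      (θ / 4) ^ (2 * Γ.card + 2) * ((bohr Γ ν).card : ℝ) ≤ (bohr Γ (θ * ν)).card)

/-- STUB 3 statement (THE ENGINE, XL; Kelley–Meka Thm 2.8/2.11/Prop 2.12 made Bohr-relative à la
Bloom–Sisask Prop 14 / Lemma 15 / Thm 16) — TWO-SET SIFTING DICHOTOMY IN `ZMod p`: `U ⊆ x + B`,
`V ⊆ y + B` (`B = bohr Γ ν` regular), a test set `T` inside the narrow core `(x − y) + B_κ` of relative
size `≥ 2^{-k}`, and a DEFICIT — `T` receives at most `1/8` of the nominal `|U||V||T|/|B|` differences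
`u − v` — force a `(1 + 1/C)`-density increment of `U` or of `V` on a translate of a regular refinement
`bohr Γ₁ ν₁` (`Γ ⊆ Γ₁`, `|Γ₁| ≤ |Γ| + C·L⁸`, `ν₁ ≤ ν`, `|bohr Γ₁ ν₁| ≥ e^{−C·siftCost}|B|`), where
`L = log(2|B|/|U|) + log(2|B|/|V|) + k`.  The size floor `|B| ≥ e^{C·siftCost}` confines the statement to
the dense regime. -/
def BohrSifting : Prop :=
  ∃ C : ℕ, 1 ≤ C ∧ ∀ (p : ℕ) [NeZero p], p.Prime →
    ∀ (Γ : Finset (ZMod p)) (ν : ℝ) (k : ℕ) (x y : ZMod p) (U V T : Finset (ZMod p)),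
    0 < ν → ν ≤ 1 / 8 → IsRegularBohr Γ ν → 1 ≤ k → U.Nonempty → V.Nonempty →
    U ⊆ (bohr Γ ν).image (x + ·) → V ⊆ (bohr Γ ν).image (y + ·) →
    T ⊆ (bohr Γ (coreWidth Γ.card * ν)).image ((x - y) + ·) →
    ((bohr Γ (coreWidth Γ.card * ν)).card : ℝ) ≤ 2 ^ k * (T.card : ℝ) →
    let L : ℝ := Real.log (2 * (bohr Γ ν).card / U.card) + Real.log (2 * (bohr Γ ν).card / V.card) + k
    Real.exp (C * siftCost Γ.card L) ≤ (bohr Γ ν).card →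
    8 * ((bohr Γ ν).card : ℝ) * (crossPairs U V T : ℝ) ≤ (U.card : ℝ) * V.card * T.card →
    ∃ Γ₁ : Finset (ZMod p), Γ ⊆ Γ₁ ∧ (Γ₁.card : ℝ) ≤ Γ.card + C * L ^ 8 ∧
      ∃ ν₁ : ℝ, 0 < ν₁ ∧ ν₁ ≤ ν ∧ IsRegularBohr Γ₁ ν₁ ∧
        Real.exp (-(C * siftCost Γ.card L)) * (bohr Γ ν).card ≤ ((bohr Γ₁ ν₁).card : ℝ) ∧
        ∃ z : ZMod p,
          (1 + 1 / (C : ℝ)) * U.card * (bohr Γ₁ ν₁).card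
              ≤ (bohr Γ ν).card * ((U ∩ (bohr Γ₁ ν₁).image (z + ·)).card : ℝ) ∨
          (1 + 1 / (C : ℝ)) * V.card * (bohr Γ₁ ν₁).card
              ≤ (bohr Γ ν).card * ((V ∩ (bohr Γ₁ ν₁).image (z + ·)).card : ℝ)

/-- STUB 4 statement (THE BET, open; implied by the crux) — THICK CORES AT DENSE WINDOW PAIRS: for a dense
(`p ≤ n s (log s)^c`) balanced SDPP family with `s ≥ s₀` and an admissible regular window `B = bohr Γ ν`
(rank `≤ (log s)^{9/10}`, `|B| ≥ p·exp(−(log s)^{19/20})`), given centre sets `𝒳`, `𝒴` on which `X`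
resp. `Y` has relative density `≥ ρ/2` in the translates of `B`, each filling `99%` of a translate of a
coarser regular window in which `B` is small, SOME pair `x ∈ 𝒳`, `y ∈ 𝒴` has a `Δ`-thick core:
`|Δ ∩ ((x − y) + B_κ)| ≥ 2·2^{-k}·|B_κ|` with `k = ⌈(log s)^{1/10}⌉`. -/
def ThickCore : Prop :=
  ∃ c : ℝ, 0 < c ∧ ∃ s₀ : ℕ, ∀ (p : ℕ) [NeZero p], p.Prime →
    ∀ (n s : ℕ) (A B : Fin n → Finset (ZMod p)), s₀ ≤ s →
    (∀ i : Fin n, (A i).card = s ∧ (B i).card = s) →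
    (∀ i : Fin n, ∀ a ∈ A i, ∀ a' ∈ A i, ∀ b ∈ B i, ∀ b' ∈ B i, (a - a') + (b - b') = 0 → a = a' ∧ b = b') →
    (∀ i j k : Fin n, ∀ a ∈ A i, ∀ a' ∈ A j, ∀ b ∈ B j, ∀ b' ∈ B k, (a - a') + (b - b') = 0 → i = k) →
    (p : ℝ) ≤ (n : ℝ) * s * Real.log s ^ c →
    ∀ (Γ : Finset (ZMod p)) (ν : ℝ), 0 < ν → ν ≤ 1 / 8 → IsRegularBohr Γ ν →
    (Γ.card : ℝ) ≤ Real.log s ^ (9 / 10 : ℝ) →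
    (p : ℝ) * Real.exp (-(Real.log s ^ (19 / 20 : ℝ))) ≤ (bohr Γ ν).card →
    ∀ (𝒳 𝒴 : Finset (ZMod p)),
    (∀ x ∈ 𝒳, (n : ℝ) * s / p / 2 * (bohr Γ ν).card
        ≤ ((blockUnion A ∩ (bohr Γ ν).image (x + ·)).card : ℝ)) →
    (∃ Γ₀ : Finset (ZMod p), Γ₀ ⊆ Γ ∧ ∃ ν₀ : ℝ, 100 * ((Γ₀.card : ℝ) + 1) * ν ≤ ν₀ ∧ ν₀ ≤ 1 / 8 ∧
        IsRegularBohr Γ₀ ν₀ ∧ ∃ x₀ : ZMod p,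
          (99 / 100 : ℝ) * (bohr Γ₀ ν₀).card ≤ ((𝒳 ∩ (bohr Γ₀ ν₀).image (x₀ + ·)).card : ℝ)) →
    (∀ y ∈ 𝒴, (n : ℝ) * s / p / 2 * (bohr Γ ν).card
        ≤ ((blockUnion B ∩ (bohr Γ ν).image (y + ·)).card : ℝ)) →
    (∃ Γ₁ : Finset (ZMod p), Γ₁ ⊆ Γ ∧ ∃ ν₁ : ℝ, 100 * ((Γ₁.card : ℝ) + 1) * ν ≤ ν₁ ∧ ν₁ ≤ 1 / 8 ∧
        IsRegularBohr Γ₁ ν₁ ∧ ∃ y₁ : ZMod p,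
          (99 / 100 : ℝ) * (bohr Γ₁ ν₁).card ≤ ((𝒴 ∩ (bohr Γ₁ ν₁).image (y₁ + ·)).card : ℝ)) →
    ∃ x ∈ 𝒳, ∃ y ∈ 𝒴,
      2 * ((bohr Γ (coreWidth Γ.card * ν)).card : ℝ)
        ≤ 2 ^ ⌈Real.log s ^ (1 / 10 : ℝ)⌉₊ *
          ((delta A B ∩ (bohr Γ (coreWidth Γ.card * ν)).image ((x - y) + ·)).card : ℝ)

/-- Conclusion of the bookkeeping stub: the crux's bound for families beyond `4×` the wall
(`4p ≤ n s²`); the sparse side is elementary and is done in `PrimeLogDecay_of`. -/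
def DenseRegimeLogDecay : Prop :=
  ∃ c : ℝ, 0 < c ∧ ∃ s₀ : ℕ, ∀ p : ℕ, p.Prime → ∀ (n s : ℕ) (A B : Fin n → Finset (ZMod p)), s₀ ≤ s →
    (∀ i : Fin n, (A i).card = s ∧ (B i).card = s) →
    (∀ i : Fin n, ∀ a ∈ A i, ∀ a' ∈ A i, ∀ b ∈ B i, ∀ b' ∈ B i, (a - a') + (b - b') = 0 → a = a' ∧ b = b') →
    (∀ i j k : Fin n, ∀ a ∈ A i, ∀ a' ∈ A j, ∀ b ∈ B j, ∀ b' ∈ B k, (a - a') + (b - b') = 0 → i = k) →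
    4 * p ≤ n * s ^ 2 →
    (n : ℝ) * (s : ℝ) * Real.log (s : ℝ) ^ c ≤ (p : ℝ)

/-! ## Registered stubs -/

/-- **stub 1 — colour deficit (provable now, M).** See `ColourDeficit`.  Tools: tree
`Literature.Computability.AlgebraicComplexity.disjoint_left_of_simultaneous` /
`disjoint_right_of_simultaneous` (blocks pairwise disjoint, needs `1 ≤ s`), `Finset.card_biUnion`,
`Finset.card_filter`/`sum_product`; the key step is F0: `u ∈ A i`, `v ∈ B k`, `u − v = a − b` with
`a ∈ A j`, `b ∈ B j` gives `(u − a) + (b − v) = 0`, so (X) at `(i, j, k)` forces `i = k`, while `v ∈ B' i`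
always qualifies (`A i − B i ⊆ Δ`). -/
theorem stub_colourDeficit : ColourDeficit := by
  sorry

/-- **stub 2 — Bohr basics (provable now, M).** See `BohrBasics`.  (i): the map
`t ↦ log |bohr Γ (2^t ν₀/2)|` is monotone on `[0,1]` with total variation `≤ (|Γ|+1) log 4` by (ii)'s
doubling bound; a point where it grows slowly on both sides (Vitali / pigeonhole on dyadic scales,
Tao–Vu Lemma 4.25) is a regular width.  (ii): cover `bohr Γ (2ν')` by the `4^{|Γ|}` classes of the map
`x ↦ (⌊signed residue of ξx / (pν'/…)⌋)_ξ`; two points in one class differ by an element of `bohr Γ ν'`. -/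
theorem stub_bohrBasics : BohrBasics := by
  sorry

/-- **stub 3 — the engine (XL).** See `BohrSifting`.  Internal structure for `--supports` lemmas:
(a) balanced decomposition on the core (`1_{x+B} ∗ 1_{−V}` is constant `= |V ∩ ((x−t)+B)| ≥ 0.9|V|`-ish
for core `t`; rim handled by regularity and the `d log d` allowance), (b) Hölder against `T`
(`|T| ≥ 2^{-k}|B_κ|`) + KM decoupling Prop 2.12 ⟹ `U` or `V` has a non-flat relative autocorrelation in
`L^{k'}`, `k' = O(k + L)`, (c) KM unbalancing (spectral positivity, Prop 2.13–2.14; BS §5 relative form) +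
sifting Lemma 2.10 + almost-periodicity BS Thm 16 ⟹ the `L^∞` increment on a regular Bohr refinement
(BS Prop 14 numerology: rank `+O(L⁴k⁴)`, size `exp(−O(d log d + L⁵k⁵))`, both `≤ C·siftCost`). -/
theorem stub_bohrSifting : BohrSifting := by
  sorry

/-- **stub 4 — THE BET (open; implied by the crux).** See `ThickCore` and the file header.  Structural
route to it (not part of this skeleton): trace identity `Y ∩ (x − Δ) = B i` for `x ∈ A i` (ideator-2 F1)
confines the partners of all blocks meeting a window to `window + Δ`; almost-periods of `Δ`
(delta-trace-rigidity F6) at the window scale; in bounded dilution `p ≤ s²e^{λ^{1/10}/2}` thickness holds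
on average over ALL cores, so only the correlation with the dense centres is at stake. -/
theorem stub_thickCore : ThickCore := by
  sorry

/-- **stub 5 — spread descent (bookkeeping, L).** See the file header (§"This skeleton") for the full
argument and budget check: penalised maximisation gives relatively spread windows for `X` (horizon
`(R₁+2)` budget units) then `Y` (1 unit per step); one narrowing (stub 2); `ThickCore` picks the pair among
the 99%-sets of near-maximal centres (Markov from spreadness + regularity); `ColourDeficit` + Markov give
the valley `T`; `BohrSifting` gives a `(1+1/C)`-increment inside both horizons, contradicting spreadness
(`(1+1/C)(1−1/(4C)) > 1 + 1/(4C)`).  Output constants: `c := c_ThickCore`, `s₀` large in terms of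
`C, c`. -/
theorem stub_spreadDescent : ColourDeficit → BohrBasics → BohrSifting → ThickCore → DenseRegimeLogDecay := by
  sorry

/-! ## Composition (kernel-checked; concludes the crux BY NAME) -/

/-- `log s ≤ s / 4` for `s ≥ 64` (via `e^{s/8} ≥ 1 + s/8` twice). -/
theorem log_le_quarter {s : ℝ} (hs : 64 ≤ s) : Real.log s ≤ s / 4 := by
  have hs0 : 0 < s := by linarith
  rw [Real.log_le_iff_le_exp hs0]
  have h1 : s / 8 + 1 ≤ Real.exp (s / 8) := Real.add_one_le_exp _
  have h2 : Real.exp (s / 4) = Real.exp (s / 8) * Real.exp (s / 8) := by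
    rw [← Real.exp_add]; ring_nf
  have h3 : 0 ≤ s / 8 + 1 := by linarith
  rw [h2]
  nlinarith [mul_le_mul h1 h1 h3 (Real.exp_pos _).le]

/-- `1 ≤ log s` for `s ≥ 64`. -/
theorem one_le_log {s : ℝ} (hs : 64 ≤ s) : 1 ≤ Real.log s := by
  have hs0 : 0 < s := by linarith
  rw [Real.le_log_iff_exp_le hs0]
  have := Real.exp_one_lt_d9
  linarith

/-- From the dense-regime statement with constants `(c, s₀)` to the disprover's explicit-constant form
`PrimeLogDecayWith (min c 1) (max s₀ 64)`: beyond `4×` the wall use the hypothesis and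
`(log s)^{min c 1} ≤ (log s)^c`; below it, `n s (log s)^{min c 1} ≤ n s · log s ≤ n s · s/4 < p`. -/
theorem primeLogDecayWith_of_dense {c : ℝ} {s₀ : ℕ} (hc : 0 < c)
    (h : ∀ p : ℕ, p.Prime → ∀ (n s : ℕ) (A B : Fin n → Finset (ZMod p)), s₀ ≤ s →
      (∀ i : Fin n, (A i).card = s ∧ (B i).card = s) →
      (∀ i : Fin n, ∀ a ∈ A i, ∀ a' ∈ A i, ∀ b ∈ B i, ∀ b' ∈ B i,
        (a - a') + (b - b') = 0 → a = a' ∧ b = b') →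
      (∀ i j k : Fin n, ∀ a ∈ A i, ∀ a' ∈ A j, ∀ b ∈ B j, ∀ b' ∈ B k,
        (a - a') + (b - b') = 0 → i = k) →
      4 * p ≤ n * s ^ 2 →
      (n : ℝ) * (s : ℝ) * Real.log (s : ℝ) ^ c ≤ (p : ℝ)) :
    PrimeLogDecayWith (min c 1) (max s₀ 64) := by
  intro p hp n s A B hs hcard hW hX
  have hs₀ : s₀ ≤ s := le_trans (le_max_left _ _) hs
  have hs64 : (64 : ℝ) ≤ s := by exact_mod_cast le_trans (le_max_right _ _) hs
  have hlog1 : 1 ≤ Real.log (s : ℝ) := one_le_log hs64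
  have hns : (0 : ℝ) ≤ (n : ℝ) * (s : ℝ) := by positivity
  have hmin : Real.log (s : ℝ) ^ (min c 1) ≤ Real.log (s : ℝ) ^ c :=
    Real.rpow_le_rpow_of_exponent_le hlog1 (min_le_left c 1)
  by_cases hwall : 4 * p ≤ n * s ^ 2
  · have key := h p hp n s A B hs₀ hcard hW hX hwall
    calc (n : ℝ) * (s : ℝ) * Real.log (s : ℝ) ^ (min c 1)
        ≤ (n : ℝ) * (s : ℝ) * Real.log (s : ℝ) ^ c := mul_le_mul_of_nonneg_left hmin hns
      _ ≤ (p : ℝ) := key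
  · have hlt : n * s ^ 2 < 4 * p := Nat.lt_of_not_le hwall
    have hltR : (n : ℝ) * (s : ℝ) ^ 2 < 4 * (p : ℝ) := by exact_mod_cast hlt
    have hone : Real.log (s : ℝ) ^ (min c 1) ≤ Real.log (s : ℝ) := by
      have := Real.rpow_le_rpow_of_exponent_le hlog1 (min_le_right c 1)
      rwa [Real.rpow_one] at this
    have hq : Real.log (s : ℝ) ≤ (s : ℝ) / 4 := log_le_quarter hs64
    calc (n : ℝ) * (s : ℝ) * Real.log (s : ℝ) ^ (min c 1)
        ≤ (n : ℝ) * (s : ℝ) * ((s : ℝ) / 4) := mul_le_mul_of_nonneg_left (hone.trans hq) hns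
      _ = (n : ℝ) * (s : ℝ) ^ 2 / 4 := by ring
      _ ≤ (p : ℝ) := by linarith

/-- THE SKELETON THEOREM: the crux `PrimeLogDecay`, by name, from the five registered stubs (its only
sorries are theirs): the four statement stubs feed `stub_spreadDescent`, whose dense-regime conclusion is
completed by the elementary sparse regime of `primeLogDecayWith_of_dense`. -/
theorem PrimeLogDecay_of : PrimeLogDecay := by
  obtain ⟨c, hc, s₀, h⟩ :=
    stub_spreadDescent stub_colourDeficit stub_bohrBasics stub_bohrSifting stub_thickCore
  exact primeLogDecay_iff.mpr ⟨min c 1, lt_min hc one_pos, max s₀ 64, primeLogDecayWith_of_dense hc h⟩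

end Summit.MatrixMultiplication.MatrixMultiplication.Cruxes.PrimeLogDecay.KmMixingColourDeficit
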